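import Literature.Barriers.Parity.SiegelZeroQuadraticPolynomialsInputsProofs
import Literature.NumberTheory.LFunctions.SiegelZeroExceptionalPrimesSecond
import Literature.NumberTheory.LFunctions.MertensElementary
import HarnessLib

/-!
# Proof of `GranvilleMollin2000_heathBrownLemma3` (Heath-Brown's Lemma 3 in the `ω`-form of
# *Rabinowitsch revisited*, §5C) from Tao–Teräväinen's Proposition 3.5

Topic `Literature/Barriers/Parity`, sibling of `SiegelZeroQuadraticPolynomialsInputs.lean`, which
vendors the second analytic input of Granville–Mollin's Theorem 4 (Acta Arith. 96 (2000), §5C: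
"In Lemma 3 of [11] it is shown that `∑_{p ≤ d^{500}} (1 + (d/p)) (log p)/p ≪ log d/√(log η)`, and so
`∑_{p ≤ d^{500}} ω(p) (log p)/p ≪ log d/√(log η)`") as the named fact
`Literature.Barriers.Parity.GranvilleMollin2000_heathBrownLemma3`. This file DISCHARGES it:
`GranvilleMollin2000_heathBrownLemma3_holds`. Everything here is PROVED; no definition is
introduced.

The printed source of the bound is Heath-Brown, *Prime twins and Siegel zeros* (1983), Lemma 3.
Tao–Teräväinen (*The Hardy–Littlewood–Chowla conjecture in the presence of a Siegel zero*, J. London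
Math. Soc. 106 (2022), §3.3) restate it as (3.11) "`∑_{p* ≤ q_χ^{500}} log p*/p* ≪ log q_χ/√(log η)`"
over the exceptional primes `p*` (`χ(p*) ≠ −1`) and remark that their Proposition 3.5 — both of
whose bounds are THEOREMS of this tree, `TaoTeravainen2021_eq313_holds`
(`SiegelZeroExceptionalPrimesProofs.lean`) and `TaoTeravainen2021_eq314_holds`
(`SiegelZeroExceptionalPrimesSecond.lean`) — recovers it. We carry out that deduction, exactly as
in the tree's proof of their Corollary 3.6 (i) (`TaoTeravainen2021_cor36_i_of_prop35`):
with `L = log q`, `s = √(log η)`, `M = ⌈s⌉ + 1` and `ω(p) = 1 + χ(p) ≤ 2 · 𝟙[p exceptional]`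
(`polyRootCountMod_eq_one_add_reChar`),

* the primes `p ≤ q^{1/M}` contribute `≤ 2 ∑_{p ≤ q^{1/M}} log p/p ≤ 2(L/M + log 4)` (Mertens'
  first theorem in Chebyshev's form, `MertensBound.sum_log_div_prime_le`);
* the exceptional primes of the window `(q^{1/m}, q^{1/(m−1)}]`, `2 ≤ m ≤ M`, contribute
  `≤ 2L · K₂ m η^{−1/m} ≤ 2L K₂ M e^{2−s}` by (3.14) (with `ε = 1`), in total
  `≤ 2L K₂ (s+2)² e^{2−s} ≤ 32e² K₂ L e^{−s/2}`;
* the exceptional primes of `(q, q^{500}]` contribute `≤ 1000 L · 500 K₁/η` by (3.13) (`ε = 1`,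
  `x = q^{500}`);

and `1/M ≤ 1/s`, `e^{−s/2} ≤ 2/s`, `1/η ≤ 1/s`, `1 ≤ L/s` (the last because `η ≤ q` for large `η`,
the Siegel bound (1.4), `SiegelZero.exists_eta_le_rpow`), whence the claim with
`K = 2 + 2 log 4 + 500000 K₁ + 64e² K₂`.

## References

* A. Granville, R. A. Mollin, *Rabinowitsch revisited*, Acta Arith. 96 (2000), 139–153, §5C.
  [GranvilleMollin2000]
* D. R. Heath-Brown, *Prime twins and Siegel zeros*, Proc. London Math. Soc. (3) 47 (1983),
  193–224, Lemma 3. [Heathbrown1983]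
* T. Tao, J. Teräväinen, *The Hardy–Littlewood–Chowla conjecture in the presence of a Siegel
  zero*, J. London Math. Soc. (2) 106 (2022), §3.3 (3.11), Proposition 3.5, Corollary 3.6.
  [TaoTeravainen2021]
-/

noncomputable section

open Finset Real
open Literature.NumberTheory.Sieve Literature.NumberTheory.LFunctions
open Literature.NumberTheory.LFunctions.SiegelZero Literature.NumberTheory.LFunctions.DirichletAbel

namespace Literature.Barriers.Parity

/-- Sums of a non-negative function over a union are at most the sum of the two sums. [folklore] -/
theorem sum_union_le_add {f : ℕ → ℝ} (hf : ∀ p, 0 ≤ f p) (s t : Finset ℕ) :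
    ∑ p ∈ s ∪ t, f p ≤ ∑ p ∈ s, f p + ∑ p ∈ t, f p := by
  have h1 := Finset.sum_union_inter (s₁ := s) (s₂ := t) (f := f)
  have h2 : 0 ≤ ∑ p ∈ s ∩ t, f p := Finset.sum_nonneg fun p _ => hf p
  linarith

/-- Sums of a non-negative function over a `biUnion` are at most the double sum. [folklore] -/
theorem sum_biUnion_le_sum_sum {f : ℕ → ℝ} (hf : ∀ p, 0 ≤ f p) (S : Finset ℕ)
    (B : ℕ → Finset ℕ) : ∑ p ∈ S.biUnion B, f p ≤ ∑ m ∈ S, ∑ p ∈ B m, f p := by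
  induction S using Finset.induction_on with
  | empty => simp
  | insert i S hi ih =>
    rw [Finset.biUnion_insert, Finset.sum_insert hi]
    exact (sum_union_le_add hf _ _).trans (by linarith)

/-- `e^{−s/2} ≤ 2/s` for `s > 0`. [folklore] -/
theorem exp_neg_half_le {s : ℝ} (hs : 0 < s) : Real.exp (-s / 2) ≤ 2 / s := by
  have h1 : s / 2 ≤ Real.exp (s / 2) := by linarith [Real.add_one_le_exp (s / 2)]
  have h2 : Real.exp (-s / 2) = (Real.exp (s / 2))⁻¹ := by
    rw [← Real.exp_neg]; congr 1; ring
  rw [h2, inv_eq_one_div, div_le_div_iff₀ (Real.exp_pos _) hs]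
  linarith

set_option maxHeartbeats 800000 in
/-- **Heath-Brown's Lemma 3 in Granville–Mollin's `ω`-form, discharged**
(`GranvilleMollin2000_heathBrownLemma3`): there are `K, η₀, d₀` such that for every negative
fundamental `d ≡ 1 (mod 4)` with `|d| ≥ d₀`, the primitive quadratic character `χ` mod `q = |d|`,
every `η ≥ η₀` with `L(1 − 1/(η log|d|), χ) = 0`:
`∑_{p ≤ |d|^{500}} ω_{f_d}(p) log p/p ≤ K log|d|/√(log η)`. Proof: Tao–Teräväinen's Proposition 3.5
(both bounds, theorems of the tree) summed over the windows `(q^{1/m}, q^{1/(m−1)}]`,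
`2 ≤ m ≤ ⌈√log η⌉ + 1`, and `(q, q^{500}]`, plus Mertens for `p ≤ q^{1/M}`; see the module
docstring. [cite: GranvilleMollin2000, §5C (display before (5.6))]
[cite: TaoTeravainen2021, §3.3 (3.11) and Proposition 3.5] -/
theorem GranvilleMollin2000_heathBrownLemma3_holds : GranvilleMollin2000_heathBrownLemma3 := by
  obtain ⟨K₁, η₁, H₁⟩ := TaoTeravainen2021_eq313_holds 1 one_pos
  obtain ⟨K₂, η₂, H₂⟩ := TaoTeravainen2021_eq314_holds 1 one_pos
  obtain ⟨η₃, H₃⟩ := exists_eta_le_rpow (ε := 1) one_pos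
  set K₁' : ℝ := max K₁ 0 with hK₁'
  set K₂' : ℝ := max K₂ 0 with hK₂'
  have hK₁'0 : 0 ≤ K₁' := le_max_right _ _
  have hK₂'0 : 0 ≤ K₂' := le_max_right _ _
  refine ⟨2 + 2 * Real.log 4 + 500000 * K₁' + 64 * Real.exp 2 * K₂',
    max (max (max η₁ η₂) η₃) (Real.exp 4), 3, ?_⟩
  intro d hd hd₀ q _ hqd χ hprim hquad η hη hzero
  -- `|d| = q` as real numbers
  have hqR : |(d : ℝ)| = (q : ℝ) := by
    have h := congrArg (fun t : ℤ => (t : ℝ)) hqd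
    simp only [Int.cast_natCast, Int.cast_abs] at h
    exact h.symm
  rw [hqR] at hd₀ hzero
  rw [hqR]
  -- the conductor and the character
  have hq0 : (0 : ℝ) < q := by linarith
  have hq1 : (1 : ℝ) < q := by linarith
  have hq2' : (2 : ℕ) ≤ q := by exact_mod_cast (show (2 : ℝ) ≤ q by linarith)
  have hχ1 : χ ≠ 1 := ne_one_of_isPrimitive hq2' hprim
  have hχsq : χ ^ 2 = 1 := hquad.sq_eq_one
  set L : ℝ := Real.log q with hLdef
  have hL1 : 1 < L := by
    rw [hLdef, Real.lt_log_iff_exp_lt hq0]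
    have := Real.exp_one_lt_d9
    linarith
  have hL0 : 0 < L := by linarith
  -- the quality `η`
  have hη₁ : η₁ ≤ η := le_trans (le_trans (le_trans (le_max_left _ _) (le_max_left _ _)) (le_max_left _ _)) hη
  have hη₂ : η₂ ≤ η := le_trans (le_trans (le_trans (le_max_right _ _) (le_max_left _ _)) (le_max_left _ _)) hη
  have hη₃ : η₃ ≤ η := le_trans (le_trans (le_max_right _ _) (le_max_left _ _)) hη
  have hηe : Real.exp 4 ≤ η := le_trans (le_max_right _ _) hη
  have hη0 : 0 < η := (Real.exp_pos 4).trans_le hηe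
  have hη1 : 1 ≤ η := by linarith [Real.add_one_le_exp (4 : ℝ)]
  have hηq : η ≤ q := by
    have h := H₃ q χ hχ1 hχsq η hη₃ hzero
    rwa [Real.rpow_one] at h
  -- `Λ = log η ≥ 4`, `s = √Λ ≥ 2`, `s ≤ L`, `s ≤ η`
  set Λ : ℝ := Real.log η with hΛdef
  have hΛ4 : 4 ≤ Λ := by rw [hΛdef, ← Real.log_exp 4]; exact Real.log_le_log (Real.exp_pos 4) hηe
  have hΛL : Λ ≤ L := Real.log_le_log hη0 hηq
  set s : ℝ := Real.sqrt Λ with hsdef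
  have hs2 : 2 ≤ s := by
    rw [hsdef, show (2 : ℝ) = Real.sqrt 4 by rw [show (4 : ℝ) = 2 ^ 2 by norm_num,
      Real.sqrt_sq (by norm_num : (0 : ℝ) ≤ 2)]]
    exact Real.sqrt_le_sqrt hΛ4
  have hs0 : 0 < s := by linarith
  have hsΛ : s ^ 2 = Λ := by rw [hsdef, Real.sq_sqrt (by linarith)]
  have hss : s ≤ s ^ 2 := by nlinarith
  have hsL : s ≤ L := hss.trans (hsΛ ▸ hΛL)
  have hsη : s ≤ η := by
    have h1 : Λ ≤ η := by
      have := Real.log_le_sub_one_of_pos hη0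
      rw [hΛdef]; linarith
    exact hss.trans (hsΛ ▸ h1)
  -- `M = ⌈s⌉ + 1`
  set M : ℕ := ⌈s⌉₊ + 1 with hMdef
  have hsM : s < M := by
    rw [hMdef]; push_cast; linarith [Nat.le_ceil s]
  have hMs : (M : ℝ) ≤ s + 2 := by
    rw [hMdef]; push_cast; linarith [Nat.ceil_lt_add_one hs0.le]
  have hM2 : 2 ≤ M := by
    have : 1 ≤ ⌈s⌉₊ := Nat.one_le_iff_ne_zero.mpr (by
      intro h; rw [Nat.ceil_eq_zero] at h; linarith)
    omega
  have hM0 : (0 : ℝ) < M := by exact_mod_cast (show 0 < M by omega)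
  -- the weights `f(p) = ω(p) log p / p`
  set f : ℕ → ℝ := fun p => (polyRootCountMod ![rabinowitschPoly d] p : ℝ) * Real.log p / p with hfdef
  have hf0 : ∀ p, 0 ≤ f p := fun p => by
    simp only [hfdef]
    exact div_nonneg (mul_nonneg (Nat.cast_nonneg _) (Real.log_natCast_nonneg p)) (Nat.cast_nonneg _)
  have hf2 : ∀ p : ℕ, p.Prime → f p ≤ 2 * (Real.log p / p) := fun p hp => by
    simp only [hfdef]
    have hω := polyRootCountMod_real_le_two hd hqd hp
    have hl : 0 ≤ Real.log p / p := div_nonneg (Real.log_natCast_nonneg p) (Nat.cast_nonneg _)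
    calc (polyRootCountMod ![rabinowitschPoly d] p : ℝ) * Real.log p / p
        = (polyRootCountMod ![rabinowitschPoly d] p : ℝ) * (Real.log p / p) := by ring
      _ ≤ 2 * (Real.log p / p) := mul_le_mul_of_nonneg_right hω hl
  have hfexc : ∀ p : ℕ, p.Prime → f p ≠ 0 → χ (p : ZMod q) ≠ -1 := fun p hp hfp hχp => by
    apply hfp
    simp only [hfdef]
    have hω := polyRootCountMod_eq_one_add_reChar hd hqd χ hprim hquad hp
    rw [reChar_apply χ hp.ne_zero, hχp] at hω
    norm_num at hω
    rw [hω]; simp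
  -- `f(p) ≤ 2 B (1/p)` when `log p ≤ B`
  have hfB : ∀ p : ℕ, p.Prime → ∀ B : ℝ, Real.log p ≤ B → f p ≤ 2 * B * (1 / p) := fun p hp B hB => by
    have hp0 : (0 : ℝ) < p := by exact_mod_cast hp.pos
    calc f p ≤ 2 * (Real.log p / p) := hf2 p hp
      _ ≤ 2 * (B / p) := by gcongr
      _ = 2 * B * (1 / p) := by ring
  -- the pieces of the cover
  set X : ℕ := ⌊(q : ℝ) ^ (500 : ℝ)⌋₊ with hXdef
  set Y : ℕ := ⌊(q : ℝ) ^ ((1 + 1) / (2 * (M : ℝ)))⌋₊ with hYdef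
  set C : Finset ℕ := Nat.primesLE Y with hCdef
  set A : Finset ℕ := excPrimes χ (Ioc ⌊(q : ℝ) ^ ((1 + 1) / 2 : ℝ)⌋₊ ⌊(q : ℝ) ^ (500 : ℝ)⌋₊) with hAdef
  set B : ℕ → Finset ℕ := fun m => excPrimes χ (Ioc ⌊(q : ℝ) ^ ((1 + 1) / (2 * (m : ℝ)))⌋₊
      ⌊(q : ℝ) ^ ((1 + 1) / (2 * ((m : ℝ) - 1)))⌋₊) with hBdef
  -- covering: a prime `p ≤ q^{500}` with `f(p) ≠ 0` is exceptional, and lies in `C`, in `A`, or in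
  -- some window `B m`, `2 ≤ m ≤ M`
  have hcover : (Nat.primesLE X).filter (fun p => f p ≠ 0) ⊆ C ∪ (A ∪ (Icc 2 M).biUnion B) := by
    intro p hp
    rw [mem_filter, Nat.mem_primesLE] at hp
    obtain ⟨⟨hpX, hpp⟩, hfp⟩ := hp
    have hpχ : χ (p : ZMod q) ≠ -1 := hfexc p hpp hfp
    rw [mem_union, mem_union, mem_biUnion]
    by_cases hpC : p ≤ Y
    · exact Or.inl (Nat.mem_primesLE.mpr ⟨hpC, hpp⟩)
    right
    rw [not_le] at hpC
    have hpY : (q : ℝ) ^ ((1 + 1) / (2 * (M : ℝ))) < p := (Nat.floor_lt (by positivity)).mp hpC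
    by_cases hpa : (q : ℝ) ^ ((1 + 1) / 2 : ℝ) < p
    · left
      rw [hAdef, mem_excPrimes, mem_Ioc]
      exact ⟨⟨(Nat.floor_lt (by positivity)).mpr hpa, hpX⟩, hpp, hpχ⟩
    · right
      rw [not_lt] at hpa
      -- the least `m ∈ [2, M]` with `q^{2/(2m)} < p`
      set T : Finset ℕ := (Icc 2 M).filter fun m => (q : ℝ) ^ ((1 + 1) / (2 * (m : ℝ))) < p with hT
      have hMT : M ∈ T := by
        rw [hT, mem_filter, mem_Icc]
        exact ⟨⟨hM2, le_rfl⟩, hpY⟩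
      have hTne : T.Nonempty := ⟨M, hMT⟩
      set m : ℕ := T.min' hTne with hm
      have hmT : m ∈ T := min'_mem T hTne
      rw [hT, mem_filter, mem_Icc] at hmT
      obtain ⟨⟨hm2, hmM⟩, hmp⟩ := hmT
      refine ⟨m, mem_Icc.mpr ⟨hm2, hmM⟩, ?_⟩
      rw [hBdef, mem_excPrimes, mem_Ioc]
      refine ⟨⟨(Nat.floor_lt (by positivity)).mpr hmp, (Nat.le_floor_iff (by positivity)).mpr ?_⟩,
        hpp, hpχ⟩
      -- `p ≤ q^{2/(2(m-1))}`
      rcases Nat.lt_or_ge 2 m with h3m | hm2'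
      · -- `m ≥ 3`: `m - 1 ∉ T` by minimality
        have hnot : m - 1 ∉ T := by
          intro hmem
          have := min'_le T (m - 1) hmem
          omega
        rw [hT, mem_filter, mem_Icc, not_and, not_lt] at hnot
        have h := hnot ⟨by omega, by omega⟩
        have hcast : (((m - 1 : ℕ) : ℝ)) = (m : ℝ) - 1 := by
          rw [Nat.cast_sub (by omega)]; simp
        rw [hcast] at h
        exact h
      · -- `m = 2`: the window ends at `q^{2/2}`
        have hm_eq : m = 2 := le_antisymm hm2' hm2
        rw [hm_eq]
        have he : (1 + 1) / (2 * (((2 : ℕ) : ℝ) - 1)) = ((1 + 1) / 2 : ℝ) := by norm_num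
        rw [he]
        exact hpa
  -- the sum over the cover
  have hsum : ∑ p ∈ Nat.primesLE X, f p ≤
      ∑ p ∈ C, f p + (∑ p ∈ A, f p + ∑ m ∈ Icc 2 M, ∑ p ∈ B m, f p) :=
    calc ∑ p ∈ Nat.primesLE X, f p = ∑ p ∈ (Nat.primesLE X).filter (fun p => f p ≠ 0), f p :=
          (Finset.sum_filter_ne_zero _).symm
      _ ≤ ∑ p ∈ C ∪ (A ∪ (Icc 2 M).biUnion B), f p :=
          sum_le_sum_of_subset_of_nonneg hcover fun p _ _ => hf0 p
      _ ≤ ∑ p ∈ C, f p + ∑ p ∈ A ∪ (Icc 2 M).biUnion B, f p := sum_union_le_add hf0 _ _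
      _ ≤ ∑ p ∈ C, f p + (∑ p ∈ A, f p + ∑ p ∈ (Icc 2 M).biUnion B, f p) := by
          gcongr; exact sum_union_le_add hf0 _ _
      _ ≤ ∑ p ∈ C, f p + (∑ p ∈ A, f p + ∑ m ∈ Icc 2 M, ∑ p ∈ B m, f p) := by
          gcongr; exact sum_biUnion_le_sum_sum hf0 _ _
  -- piece `C`: Mertens
  have hCle : ∑ p ∈ C, f p ≤ 2 * (L / M) + 2 * Real.log 4 := by
    have h1 : ∑ p ∈ C, f p ≤ ∑ p ∈ C, 2 * (Real.log p / p) :=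
      sum_le_sum fun p hp => hf2 p (Nat.prime_of_mem_primesLE hp)
    have h2 : ∑ p ∈ C, 2 * (Real.log p / p) = 2 * ∑ p ∈ Nat.primesLE Y, Real.log p / p := by
      rw [hCdef, ← mul_sum]
    have h3 := MertensBound.sum_log_div_prime_le Y
    have h4 : Real.log Y ≤ L / M := by
      rcases Nat.eq_zero_or_pos Y with hY | hY
      · rw [hY, Nat.cast_zero, Real.log_zero]; positivity
      · have hY0 : (0 : ℝ) < Y := by exact_mod_cast hY
        calc Real.log Y ≤ Real.log ((q : ℝ) ^ ((1 + 1) / (2 * (M : ℝ)))) :=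
              Real.log_le_log hY0 (Nat.floor_le (by positivity))
          _ = (1 + 1) / (2 * (M : ℝ)) * L := by rw [Real.log_rpow hq0]
          _ = L / M := by field_simp; ring
    linarith
  -- piece `A`: (3.13) with `ε = 1`, `x = q^{500}`
  have hAle : ∑ p ∈ A, f p ≤ 500000 * K₁' * (L / η) := by
    have hx : (q : ℝ) ^ ((1 + 1) / 2 : ℝ) ≤ (q : ℝ) ^ (500 : ℝ) :=
      Real.rpow_le_rpow_of_exponent_le hq1.le (by norm_num)
    have h := H₁ q χ hprim hquad η hη₁ hzero ((q : ℝ) ^ (500 : ℝ)) hx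
    have hlogx : Real.log ((q : ℝ) ^ (500 : ℝ)) / Real.log q = 500 := by
      rw [Real.log_rpow hq0, ← hLdef]; field_simp [hL0.ne']
    rw [hlogx] at h
    -- `f(p) ≤ 1000 L (1/p)` on `A` (`p ≤ q^{500}`)
    have h1 : ∑ p ∈ A, f p ≤ ∑ p ∈ A, 2 * (500 * L) * (1 / (p : ℝ)) := by
      refine sum_le_sum fun p hp => ?_
      rw [hAdef, mem_excPrimes, mem_Ioc] at hp
      obtain ⟨⟨-, hpX⟩, hpp, -⟩ := hp
      refine hfB p hpp _ ?_
      have hp0 : (0 : ℝ) < p := by exact_mod_cast hpp.pos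
      have hpx : (p : ℝ) ≤ (q : ℝ) ^ (500 : ℝ) := (Nat.le_floor_iff (by positivity)).mp hpX
      calc Real.log p ≤ Real.log ((q : ℝ) ^ (500 : ℝ)) := Real.log_le_log hp0 hpx
        _ = 500 * L := by rw [Real.log_rpow hq0]
    rw [← mul_sum] at h1
    have h2 : K₁ * 500 / η ≤ K₁' * 500 / η :=
      div_le_div_of_nonneg_right (mul_le_mul_of_nonneg_right (le_max_left _ _) (by norm_num)) hη0.le
    calc ∑ p ∈ A, f p ≤ 2 * (500 * L) * ∑ p ∈ A, 1 / (p : ℝ) := h1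
      _ ≤ 2 * (500 * L) * (K₁' * 500 / η) :=
          mul_le_mul_of_nonneg_left (h.trans h2) (by positivity)
      _ = 500000 * K₁' * (L / η) := by ring
  -- pieces `B m`: (3.14) with `ε = 1`
  have hBle : ∀ m ∈ Icc 2 M, ∑ p ∈ B m, f p ≤ 2 * L * (K₂' * M * Real.exp (2 - s)) := by
    intro m hm
    rw [mem_Icc] at hm
    have hm0 : (0 : ℝ) < m := by exact_mod_cast (show 0 < m by omega)
    have hmr : (2 : ℝ) ≤ m := by exact_mod_cast hm.1
    have h := H₂ q χ hprim hquad η hη₂ hzero m hm.1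
    -- `f(p) ≤ 2 L (1/p)` on `B m` (`p ≤ q^{1/(m-1)} ≤ q`)
    have hexp : (1 + 1) / (2 * ((m : ℝ) - 1)) ≤ (1 : ℝ) := by
      rw [div_le_one (by linarith)]; linarith
    have h1 : ∑ p ∈ B m, f p ≤ ∑ p ∈ B m, 2 * L * (1 / (p : ℝ)) := by
      refine sum_le_sum fun p hp => ?_
      have hp' := hp
      rw [mem_excPrimes, mem_Ioc] at hp'
      obtain ⟨⟨-, hpZ⟩, hpp, -⟩ := hp'
      refine hfB p hpp _ ?_
      have hp0 : (0 : ℝ) < p := by exact_mod_cast hpp.pos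
      have hpz : (p : ℝ) ≤ (q : ℝ) ^ ((1 + 1) / (2 * ((m : ℝ) - 1))) :=
        (Nat.le_floor_iff (by positivity)).mp hpZ
      calc Real.log p ≤ Real.log ((q : ℝ) ^ ((1 + 1) / (2 * ((m : ℝ) - 1)))) := Real.log_le_log hp0 hpz
        _ ≤ Real.log ((q : ℝ) ^ (1 : ℝ)) :=
            Real.log_le_log (by positivity) (Real.rpow_le_rpow_of_exponent_le hq1.le hexp)
        _ = L := by rw [Real.rpow_one]
    rw [← mul_sum] at h1
    have hpow : η ^ ((1 : ℝ) / m) ≥ η ^ ((1 : ℝ) / M) :=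
      Real.rpow_le_rpow_of_exponent_le hη1 (by
        rw [div_le_div_iff_of_pos_left one_pos hM0 hm0]; exact_mod_cast hm.2)
    have hpowM : η ^ ((1 : ℝ) / M) = Real.exp (Λ / M) := by
      rw [Real.rpow_def_of_pos hη0, hΛdef]; ring_nf
    have hpowpos : 0 < η ^ ((1 : ℝ) / m) := Real.rpow_pos_of_pos hη0 _
    have hΛM : s - 2 ≤ Λ / M := by
      rw [le_div_iff₀ hM0]
      nlinarith
    have h3 : ∑ p ∈ B m, (1 : ℝ) / p ≤ K₂' * M * Real.exp (2 - s) :=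
      calc ∑ p ∈ B m, (1 : ℝ) / p ≤ K₂ * m / η ^ ((1 : ℝ) / m) := h
        _ ≤ K₂' * M / η ^ ((1 : ℝ) / M) := by
            have hnum : K₂ * m ≤ K₂' * M :=
              (mul_le_mul_of_nonneg_right (le_max_left _ _) hm0.le).trans
                (mul_le_mul_of_nonneg_left (by exact_mod_cast hm.2) hK₂'0)
            have hnum0 : 0 ≤ K₂' * M := mul_nonneg hK₂'0 hM0.le
            calc K₂ * m / η ^ ((1 : ℝ) / m) ≤ K₂' * M / η ^ ((1 : ℝ) / m) :=
                  div_le_div_of_nonneg_right hnum hpowpos.le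
              _ ≤ K₂' * M / η ^ ((1 : ℝ) / M) :=
                  div_le_div_of_nonneg_left hnum0 (Real.rpow_pos_of_pos hη0 _) hpow
        _ = K₂' * M * Real.exp (-(Λ / M)) := by rw [hpowM, Real.exp_neg, div_eq_mul_inv]
        _ ≤ K₂' * M * Real.exp (2 - s) := by
            refine mul_le_mul_of_nonneg_left (Real.exp_le_exp.mpr (by linarith))
              (mul_nonneg hK₂'0 hM0.le)
    calc ∑ p ∈ B m, f p ≤ 2 * L * ∑ p ∈ B m, 1 / (p : ℝ) := h1
      _ ≤ 2 * L * (K₂' * M * Real.exp (2 - s)) := mul_le_mul_of_nonneg_left h3 (by positivity)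
  have hBsum : ∑ m ∈ Icc 2 M, ∑ p ∈ B m, f p ≤ 2 * L * (16 * Real.exp 2 * K₂' * Real.exp (-s / 2)) :=
    calc ∑ m ∈ Icc 2 M, ∑ p ∈ B m, f p ≤ ∑ _m ∈ Icc 2 M, 2 * L * (K₂' * M * Real.exp (2 - s)) :=
          sum_le_sum hBle
      _ = ((M + 1 - 2 : ℕ) : ℝ) * (2 * L * (K₂' * M * Real.exp (2 - s))) := by
          rw [sum_const, Nat.card_Icc, nsmul_eq_mul]
      _ ≤ (M : ℝ) * (2 * L * (K₂' * M * Real.exp (2 - s))) := by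
          refine mul_le_mul_of_nonneg_right ?_ (by positivity)
          exact_mod_cast (show M + 1 - 2 ≤ M by omega)
      _ = 2 * L * (K₂' * ((M : ℝ) ^ 2 * Real.exp (2 - s))) := by ring
      _ ≤ 2 * L * (K₂' * ((s + 2) ^ 2 * Real.exp (2 - s))) := by gcongr
      _ ≤ 2 * L * (K₂' * (16 * Real.exp 2 * Real.exp (-s / 2))) :=
          mul_le_mul_of_nonneg_left (mul_le_mul_of_nonneg_left (sq_mul_exp_le hs0.le) hK₂'0)
            (by positivity)
      _ = 2 * L * (16 * Real.exp 2 * K₂' * Real.exp (-s / 2)) := by ring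
  -- the small factors against `L/s`
  have hLs1 : 1 ≤ L / s := by rw [le_div_iff₀ hs0]; linarith
  have hLs0 : 0 ≤ L / s := by linarith
  have e1 : 2 * (L / M) ≤ 2 * (L / s) := by
    have hsM' : s ≤ M := hsM.le
    gcongr
  have e2 : 2 * Real.log 4 ≤ 2 * Real.log 4 * (L / s) := by
    have hl4 : 0 ≤ Real.log 4 := Real.log_nonneg (by norm_num)
    nlinarith
  have e3 : 500000 * K₁' * (L / η) ≤ 500000 * K₁' * (L / s) := by
    gcongr
  have e4 : 2 * L * (16 * Real.exp 2 * K₂' * Real.exp (-s / 2)) ≤ 64 * Real.exp 2 * K₂' * (L / s) := by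
    have h := exp_neg_half_le hs0
    calc 2 * L * (16 * Real.exp 2 * K₂' * Real.exp (-s / 2))
        = 32 * Real.exp 2 * K₂' * L * Real.exp (-s / 2) := by ring
      _ ≤ 32 * Real.exp 2 * K₂' * L * (2 / s) := mul_le_mul_of_nonneg_left h (by positivity)
      _ = 64 * Real.exp 2 * K₂' * (L / s) := by ring
  calc ∑ p ∈ Nat.primesLE X, f p
      ≤ ∑ p ∈ C, f p + (∑ p ∈ A, f p + ∑ m ∈ Icc 2 M, ∑ p ∈ B m, f p) := hsum
    _ ≤ (2 * (L / M) + 2 * Real.log 4) + (500000 * K₁' * (L / η) +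
          2 * L * (16 * Real.exp 2 * K₂' * Real.exp (-s / 2))) := add_le_add hCle (add_le_add hAle hBsum)
    _ ≤ (2 * (L / s) + 2 * Real.log 4 * (L / s)) + (500000 * K₁' * (L / s) +
          64 * Real.exp 2 * K₂' * (L / s)) := add_le_add (add_le_add e1 e2) (add_le_add e3 e4)
    _ = (2 + 2 * Real.log 4 + 500000 * K₁' + 64 * Real.exp 2 * K₂') * (L / s) := by ring

end Literature.Barriers.Parity
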